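import Summits.CriticalPhenomena.CardyFormulaZ2.Theorems.CardyIKTransportIKLinearTransportSDECore4

/-!
# Stub `stub_StripDiagramExchange` — core part 5: the events of the limit argument

Continues `…SDECore4`. Locality of the strip observables in the window bits (`SDE.col_local`, `SDE.DgW_local`); the
events of the limit argument — boundary condition `SDE.Bev`, the target event `SDE.Einf` (boundary condition +
prescribed strip connections), its window approximations `SDE.Ewin` (increasing, exhausting), the exit event `SDE.Gex`,
the cylinder event `SDE.Ecyl` read off the window `[a_N, a_N + N]`, `a_N = -⌊N/2⌋` — the two INCLUSIONS
`Ewin ∩ Per ⊆ Ecyl ⊆ Ewin ∪ Gex`, and the determination of these events by the window bits.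
-/

set_option autoImplicit false

noncomputable section

namespace Summit.CriticalPhenomena.CardyFormulaZ2.Theorems.IKLinearTransport.PinnedDiagramExchange

open scoped Classical MeasureTheory ENNReal ProbabilityTheory BigOperators
open MeasureTheory Literature.Probability.Percolation Literature.Probability.LatticeModels

namespace SDE

/-! ## §12 Locality of the strip observables -/

/-- Two bit configurations agreeing on the window bits have the same strip colours on the window. [folklore] -/
theorem col_local (τ κ₀ κ₂ : Bool) {lo hi : ℤ} (hlo : lo ≤ 0) (hhi : 0 ≤ hi) {b b' : K}
    (h : ∀ j ∈ Jw lo hi, b j = b' j) (j : Fin 3) (y : ℤ) (h1 : lo ≤ y) (h2 : y ≤ hi) :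
    col τ κ₀ κ₂ b j y = col τ κ₀ κ₂ b' j y := by
  have h0 : b (0, y) = b' (0, y) := h _ ((mem_Jw lo hi 0 y).2 (Or.inl ⟨rfl, h1, h2⟩))
  have h4 : b (4, 1) = b' (4, 1) := h _ ((mem_Jw lo hi 4 1).2 (Or.inr (Or.inl ⟨rfl, rfl⟩)))
  have hk : ∀ k : Fin 5, (k = 1 ∨ k = 2 ∨ k = 3) → bp (fun s => b (k, s)) 0 y = bp (fun s => b' (k, s)) 0 y :=
    fun k hk => bp_congr fun s hs1 hs2 => h _ ((mem_Jw lo hi k s).2 (Or.inr (Or.inr ⟨hk, by omega, by omega⟩)))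
  have h13 : ∀ τ' : Bool, (kL τ' = 1 ∨ kL τ' = 2 ∨ kL τ' = 3) := by decide
  fin_cases j
  · simp only [Fin.zero_eta, col_zero, h0]
  · simp only [Fin.mk_one, col_one, h0, h4, hk (kL τ) (h13 τ)]
  · simp only [Fin.reduceFinMk, col_two, h0, hk 1 (Or.inl rfl), hk 3 (Or.inr (Or.inr rfl))]

/-- Same for the flags of the window faces. [folklore] -/
theorem flag_local (τ : Bool) {lo hi : ℤ} {b b' : K} (h : ∀ j ∈ Jw lo hi, b j = b' j) (j : Fin 2) (y : ℤ)
    (h1 : lo ≤ y) (h2 : y < hi) : flag τ b j y = flag τ b' j y := by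
  have h2' : b (2, y) = b' (2, y) := h _ ((mem_Jw lo hi 2 y).2 (Or.inr (Or.inr ⟨Or.inr (Or.inl rfl), h1, h2⟩)))
  fin_cases j <;> cases τ <;> simp [h2']

/-- Agreement of colours on the window cells of the strip. [folklore] -/
theorem memX_local (i : ℤ) (τ κ₀ κ₂ : Bool) {lo hi : ℤ} (hlo : lo ≤ 0) (hhi : 0 ≤ hi) {b b' : K}
    (h : ∀ j ∈ Jw lo hi, b j = b' j) (v : Site 2) (hv0 : i ≤ v 0) (hv0' : v 0 ≤ i + 2) (hv1 : lo ≤ v 1)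
    (hv1' : v 1 ≤ hi) : v ∈ (X i τ κ₀ κ₂ b).1 ↔ v ∈ (X i τ κ₀ κ₂ b').1 := by
  have hj : v 0 = i + ((⟨(v 0 - i).toNat, by omega⟩ : Fin 3) : ℕ) := by simp; omega
  rw [mem_X_iff i τ κ₀ κ₂ b v _ hj, mem_X_iff i τ κ₀ κ₂ b' v _ hj, col_local τ κ₀ κ₂ hlo hhi h _ _ hv1 hv1']

/-- Agreement of the triangulation on the window cells of the strip. [folklore] -/
theorem adjX_local (i : ℤ) (τ κ₀ κ₂ : Bool) {lo hi : ℤ} {b b' : K} (h : ∀ j ∈ Jw lo hi, b j = b' j) (u v : Site 2)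
    (hu0 : i ≤ u 0) (hu0' : u 0 ≤ i + 2) (hu1 : lo ≤ u 1) (hu1' : u 1 ≤ hi)
    (hv0 : i ≤ v 0) (hv0' : v 0 ≤ i + 2) (hv1 : lo ≤ v 1) (hv1' : v 1 ≤ hi) :
    (cellGraph (X i τ κ₀ κ₂ b).2).Adj u v ↔ (cellGraph (X i τ κ₀ κ₂ b').2).Adj u v := by
  rw [cellGraph_adj_iff, cellGraph_adj_iff]
  have e := grid_adj_map (fun c d => (![c, d] : Site 2) ∈ (X i τ κ₀ κ₂ b).2)
    (fun c d => (![c, d] : Site 2) ∈ (X i τ κ₀ κ₂ b').2) 0 0 (u 0, u 1) (v 0, v 1) (fun c d hc hd => ?_)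
  · simpa using e
  simp only at hc hd
  by_cases hc2 : c = i + 2
  · simp only [add_zero, X, Set.mem_setOf_eq, Matrix.cons_val_zero, Matrix.cons_val_one]
    constructor <;> intro _ j hj <;> (have := j.2; omega)
  · have hj : (![c, d] : Site 2) 0 = i + ((⟨(c - i).toNat, by omega⟩ : Fin 2) : ℕ) := by simp; omega
    rw [add_zero, add_zero, mem_X2_iff i τ κ₀ κ₂ b _ _ hj, mem_X2_iff i τ κ₀ κ₂ b' _ _ hj,
      show (![c, d] : Site 2) 1 = d from rfl, flag_local τ h _ d (by omega) (by omega)]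

/-- Reachability inside a window colour class only reads the window. [folklore] -/
theorem reachW_local (i : ℤ) (τ κ₀ κ₂ : Bool) {lo hi : ℤ} (hlo : lo ≤ 0) (hhi : 0 ≤ hi) {b b' : K}
    (h : ∀ j ∈ Jw lo hi, b j = b' j) (p q : Site 2) (hp0 : i ≤ p 0) (hp0' : p 0 ≤ i + 2) (hp1 : lo ≤ p 1) (hp1' : p 1 ≤ hi) :
    (within (cellGraph (X i τ κ₀ κ₂ b).2) (clsW (X i τ κ₀ κ₂ b) i lo hi p)).Reachable p q →
      (within (cellGraph (X i τ κ₀ κ₂ b').2) (clsW (X i τ κ₀ κ₂ b') i lo hi p)).Reachable p q := by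
  intro hr
  have hset : clsW (X i τ κ₀ κ₂ b) i lo hi p ⊆ clsW (X i τ κ₀ κ₂ b') i lo hi p := by
    rintro v ⟨⟨hc, h0, h0'⟩, h1, h1'⟩
    refine ⟨⟨?_, h0, h0'⟩, h1, h1'⟩
    rw [← memX_local i τ κ₀ κ₂ hlo hhi h v h0 h0' h1 h1', ← memX_local i τ κ₀ κ₂ hlo hhi h p hp0 hp0' hp1 hp1']
    exact hc
  refine within_mono _ hset (within_mono_graph _ (fun u v hu hv huv => ?_) hr)
  exact (adjX_local i τ κ₀ κ₂ h u v hu.1.2.1 hu.1.2.2 hu.2.1 hu.2.2 hv.1.2.1 hv.1.2.2 hv.2.1 hv.2.2).1 huv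

/-- Window diagrams only read the window. [folklore] -/
theorem DgW_local (i : ℤ) (τ κ₀ κ₂ : Bool) {lo hi : ℤ} (hlo : lo ≤ 0) (hhi : 0 ≤ hi) {b b' : K}
    (h : ∀ j ∈ Jw lo hi, b j = b' j) (pq : Site 2 × Site 2) :
    pq ∈ DgW i lo hi (X i τ κ₀ κ₂ b) → pq ∈ DgW i lo hi (X i τ κ₀ κ₂ b') := by
  rintro ⟨h1, h2, ⟨⟨hqc, hq0, hq0'⟩, hq1, hq1'⟩, ⟨⟨-, hp0, hp0'⟩, hp1, hp1'⟩, hr⟩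
  refine ⟨h1, h2, ⟨⟨?_, hq0, hq0'⟩, hq1, hq1'⟩, ⟨⟨Iff.rfl, hp0, hp0'⟩, hp1, hp1'⟩,
    reachW_local i τ κ₀ κ₂ hlo hhi h _ _ hp0 hp0' hp1 hp1' hr⟩
  rw [← memX_local i τ κ₀ κ₂ hlo hhi h _ hq0 hq0' hq1 hq1', ← memX_local i τ κ₀ κ₂ hlo hhi h _ hp0 hp0' hp1 hp1']
  exact hqc

/-! ## §13 The events of the limit argument -/

/-- Events determined by the bits in `J`. [folklore] -/
def DetSets (J : Finset Idx) : Set (Set K) := {E | ∀ b b' : K, (∀ j ∈ J, b j = b' j) → (b ∈ E ↔ b' ∈ E)}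

/-- Boundary-condition event: prescribed boundary colours on the rows `F`. [folklore] -/
def Bev (κ₀ κ₂ : Bool) (F₁ F₂ : Finset ℤ) (g₁ g₂ : ℤ → Bool) : Set K :=
  {b | (∀ y ∈ F₁, (bdry κ₀ κ₂ b).1 y = g₁ y) ∧ ∀ y ∈ F₂, (bdry κ₀ κ₂ b).2 y = g₂ y}

/-- THE TARGET EVENT: boundary condition and prescribed strip connections. [folklore] -/
def Einf (i : ℤ) (τ κ₀ κ₂ : Bool) (F₁ F₂ : Finset ℤ) (g₁ g₂ : ℤ → Bool) (Pp : Finset (Site 2 × Site 2)) : Set K :=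
  Bev κ₀ κ₂ F₁ F₂ g₁ g₂ ∩ {b | ∀ pq ∈ Pp, pq ∈ stripDiagram i (X i τ κ₀ κ₂ b)}

/-- Its window approximation: connections inside the rows `[-m, m]`. [folklore] -/
def Ewin (i : ℤ) (τ κ₀ κ₂ : Bool) (F₁ F₂ : Finset ℤ) (g₁ g₂ : ℤ → Bool) (Pp : Finset (Site 2 × Site 2)) (m : ℕ) : Set K :=
  Bev κ₀ κ₂ F₁ F₂ g₁ g₂ ∩ {b | ∀ pq ∈ Pp, pq ∈ DgW i (-m) m (X i τ κ₀ κ₂ b)}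

/-- THE EXIT EVENT: a monochromatic strip path from a start cell to an extreme row of the window `[-m, m]`. [folklore] -/
def Gex (i : ℤ) (τ κ₀ κ₂ : Bool) (Pp : Finset (Site 2 × Site 2)) (m : ℕ) : Set K :=
  {b | ∃ pq ∈ Pp, ∃ w : Site 2, (w 1 = -m ∨ w 1 = m) ∧
    (within (cellGraph (X i τ κ₀ κ₂ b).2) (clsW (X i τ κ₀ κ₂ b) i (-m) m pq.1)).Reachable pq.1 w}

/-- The window offset of the cylinder of circumference `N`: rows `[a_N, a_N + N]`, `a_N = -⌊N/2⌋`. [folklore] -/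
def aN (N : ℕ) : ℤ := -((N / 2 : ℕ) : ℤ)

/-- Side of a boundary cell. [folklore] -/
def side (i : ℤ) (p : Site 2) : Fin 2 := if p 0 = i then 0 else 1

/-- Boundary cell of the strip ↦ boundary cell of the cylinder. [folklore] -/
def σ₂ (i a : ℤ) (N : ℕ) (p : Site 2) : Fin 2 × ZMod N := (side i p, zOf a N (p 1))

/-- THE CYLINDER EVENT: boundary condition and prescribed boundary connections of the cylinder read off the window. [folklore] -/
def Fcyl (i a : ℤ) (N : ℕ) (F₁ F₂ : Finset ℤ) (g₁ g₂ : ℤ → Bool) (Pp : Finset (Site 2 × Site 2)) : Set (CylCfg N) :=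
  {cfg | ((∀ y ∈ F₁, cfg.1 (0, zOf a N y) = g₁ y) ∧ ∀ y ∈ F₂, cfg.1 (2, zOf a N y) = g₂ y) ∧
    ∀ pq ∈ Pp, (σ₂ i a N pq.1, σ₂ i a N pq.2) ∈ blockDiagram N cfg.1 cfg.2}

/-- The cylinder event as an event of the core bits, jointly with periodicity. [folklore] -/
def Ecyl (i : ℤ) (τ κ₀ κ₂ : Bool) (F₁ F₂ : Finset ℤ) (g₁ g₂ : ℤ → Bool) (Pp : Finset (Site 2 × Site 2)) (N : ℕ) : Set K :=
  {b | cylMap (aN N) N τ κ₀ κ₂ b ∈ Fcyl i (aN N) N F₁ F₂ g₁ g₂ Pp} ∩ Per (aN N) N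

/-- `Fcyl` has the shape required by the cylinder exchange. [folklore] -/
theorem Fcyl_shape (i a : ℤ) (N : ℕ) (F₁ F₂ : Finset ℤ) (g₁ g₂ : ℤ → Bool) (Pp : Finset (Site 2 × Site 2)) :
    ∃ (C : (ZMod N → Bool) → (ZMod N → Bool) → Prop) (Pp' : Set ((Fin 2 × ZMod N) × (Fin 2 × ZMod N))),
      ∀ cfg, cfg ∈ Fcyl i a N F₁ F₂ g₁ g₂ Pp ↔ (C (fun r => cfg.1 (0, r)) (fun r => cfg.1 (2, r)) ∧ Pp' ⊆ blockDiagram N cfg.1 cfg.2) :=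
  ⟨fun ξ ζ => (∀ y ∈ F₁, ξ (zOf a N y) = g₁ y) ∧ ∀ y ∈ F₂, ζ (zOf a N y) = g₂ y,
    (fun pq : Site 2 × Site 2 => (σ₂ i a N pq.1, σ₂ i a N pq.2)) '' ↑Pp, fun cfg => by
      simp only [Fcyl, Set.mem_setOf_eq, Set.image_subset_iff]
      rfl⟩

/-- Bounds of the cylinder window. [folklore] -/
theorem aN_bounds (N m : ℕ) (h : 2 * m + 4 ≤ N) : aN N + 1 ≤ -(m : ℤ) ∧ (m : ℤ) + 1 < aN N + N ∧ aN N ≤ 0 ∧ 0 ≤ aN N + N := by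
  simp only [aN]; omega

/-- The boundary cells of the cylinder under `σ₂` are the cells `σ`. [folklore] -/
theorem cell_σ₂ (i a : ℤ) (N : ℕ) (p : Site 2) (hp : p 0 = i ∨ p 0 = i + 2) :
    ((![0, 2] : Fin 2 → Fin 3) (σ₂ i a N p).1, (σ₂ i a N p).2) = σ i a N p := by
  refine Prod.ext ?_ rfl
  show (![0, 2] : Fin 2 → Fin 3) (side i p) = fin3 i p
  rcases hp with hp | hp
  · have h1 : side i p = 0 := by simp [side, hp]
    have h2 : fin3 i p = 0 := by
      simp only [fin3, dif_pos (show 0 ≤ p 0 - i ∧ p 0 - i ≤ 2 by omega)]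
      exact Fin.ext (show (p 0 - i).toNat = 0 by omega)
    rw [h1, h2]; rfl
  · have h1 : side i p = 1 := by simp [side, show p 0 ≠ i by omega]
    have h2 : fin3 i p = 2 := by
      simp only [fin3, dif_pos (show 0 ≤ p 0 - i ∧ p 0 - i ≤ 2 by omega)]
      exact Fin.ext (show (p 0 - i).toNat = 2 by omega)
    rw [h1, h2]; rfl

/-- Boundary colours of the cylinder read off the strip. [folklore] -/
theorem cyl_bdry (a : ℤ) (N : ℕ) [NeZero N] (τ κ₀ κ₂ : Bool) (b : K) (y : ℤ) (h1 : a ≤ y) (h2 : y < a + N) :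
    (cylMap a N τ κ₀ κ₂ b).1 (0, zOf a N y) = (bdry κ₀ κ₂ b).1 y ∧ (cylMap a N τ κ₀ κ₂ b).1 (2, zOf a N y) = (bdry κ₀ κ₂ b).2 y := by
  simp only [cylMap, rowOf_zOf a h1 h2, bdry_eq τ, and_self]

/-- INCLUSION (a): window connections of the strip are connections of the cylinder. [folklore] -/
theorem Ewin_subset_Ecyl (i : ℤ) (τ κ₀ κ₂ : Bool) (F₁ F₂ : Finset ℤ) (g₁ g₂ : ℤ → Bool) (Pp : Finset (Site 2 × Site 2))
    (m N : ℕ) [NeZero N] (hN : 2 * m + 4 ≤ N) (hF : ∀ y ∈ F₁ ∪ F₂, -(m : ℤ) ≤ y ∧ y ≤ m) :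
    Ewin i τ κ₀ κ₂ F₁ F₂ g₁ g₂ Pp m ∩ Per (aN N) N ⊆ Ecyl i τ κ₀ κ₂ F₁ F₂ g₁ g₂ Pp N := by
  obtain ⟨ha1, ha2, -, -⟩ := aN_bounds N m hN
  rintro b ⟨⟨⟨hB1, hB2⟩, hD⟩, hP⟩
  refine ⟨⟨⟨fun y hy => ?_, fun y hy => ?_⟩, fun pq hpq => ?_⟩, hP⟩
  · have hy' := hF y (Finset.mem_union_left _ hy)
    rw [(cyl_bdry (aN N) N τ κ₀ κ₂ b y (by omega) (by omega)).1]; exact hB1 y hy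
  · have hy' := hF y (Finset.mem_union_right _ hy)
    rw [(cyl_bdry (aN N) N τ κ₀ κ₂ b y (by omega) (by omega)).2]; exact hB2 y hy
  · obtain ⟨h1, h2, -, -, hr⟩ := hD pq hpq
    show _ ∈ blockDiagram N _ _
    simp only [blockDiagram, Set.mem_setOf_eq, mem_blockCluster_iff, cell_σ₂ i (aN N) N _ h1, cell_σ₂ i (aN N) N _ h2]
    exact reach_cyl_of_strip i (aN N) τ κ₀ κ₂ b ha1 ha2 hr

/-- INCLUSION (b)+(c): a connection of the cylinder is a window connection of the strip or an exit. [folklore] -/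
theorem Ecyl_subset (i : ℤ) (τ κ₀ κ₂ : Bool) (F₁ F₂ : Finset ℤ) (g₁ g₂ : ℤ → Bool) (Pp : Finset (Site 2 × Site 2))
    (m N : ℕ) [NeZero N] (hN : 2 * m + 4 ≤ N) (hF : ∀ y ∈ F₁ ∪ F₂, -(m : ℤ) ≤ y ∧ y ≤ m)
    (hPp : ∀ pq ∈ Pp, (pq.1 0 = i ∨ pq.1 0 = i + 2) ∧ (pq.2 0 = i ∨ pq.2 0 = i + 2) ∧
      (-(m : ℤ) ≤ pq.1 1 ∧ pq.1 1 ≤ m) ∧ (-(m : ℤ) ≤ pq.2 1 ∧ pq.2 1 ≤ m)) :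
    Ecyl i τ κ₀ κ₂ F₁ F₂ g₁ g₂ Pp N ⊆ Ewin i τ κ₀ κ₂ F₁ F₂ g₁ g₂ Pp m ∪ Gex i τ κ₀ κ₂ Pp m := by
  obtain ⟨ha1, ha2, -, -⟩ := aN_bounds N m hN
  rintro b ⟨⟨⟨hB1, hB2⟩, hD⟩, hP⟩
  have hBev : b ∈ Bev κ₀ κ₂ F₁ F₂ g₁ g₂ := by
    refine ⟨fun y hy => ?_, fun y hy => ?_⟩
    · have hy' := hF y (Finset.mem_union_left _ hy)
      rw [← (cyl_bdry (aN N) N τ κ₀ κ₂ b y (by omega) (by omega)).1]; exact hB1 y hy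
    · have hy' := hF y (Finset.mem_union_right _ hy)
      rw [← (cyl_bdry (aN N) N τ κ₀ κ₂ b y (by omega) (by omega)).2]; exact hB2 y hy
  have hreach : ∀ pq ∈ Pp, (blockGraph N (cylMap (aN N) N τ κ₀ κ₂ b).2 ⊓ monoGraph (cylMap (aN N) N τ κ₀ κ₂ b).1).Reachable
      (σ i (aN N) N pq.1) (σ i (aN N) N pq.2) := fun pq hpq => by
    have e := hD pq hpq
    simp only [blockDiagram, Set.mem_setOf_eq, mem_blockCluster_iff, cell_σ₂ i (aN N) N _ (hPp pq hpq).1,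
      cell_σ₂ i (aN N) N _ (hPp pq hpq).2.1] at e
    exact e
  have hcol : ∀ p : Site 2, (p 0 = i ∨ p 0 = i + 2) → i ≤ p 0 ∧ p 0 ≤ i + 2 := fun p hp => by omega
  by_cases hall : ∀ pq ∈ Pp, (within (cellGraph (X i τ κ₀ κ₂ b).2) (clsW (X i τ κ₀ κ₂ b) i (-m) m pq.1)).Reachable pq.1 pq.2
  · left
    refine ⟨hBev, fun pq hpq => ?_⟩
    obtain ⟨h1, h2, h3, h4⟩ := hPp pq hpq
    have hp : pq.1 ∈ clsW (X i τ κ₀ κ₂ b) i (-m) m pq.1 := ⟨⟨Iff.rfl, hcol _ h1⟩, h3⟩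
    exact ⟨h1, h2, within_reachable_mem _ _ (hall pq hpq) hp, hp, hall pq hpq⟩
  · right
    push Not at hall
    obtain ⟨pq, hpq, hnot⟩ := hall
    obtain ⟨h1, h2, h3, h4⟩ := hPp pq hpq
    rcases strip_dichotomy i (aN N) τ κ₀ κ₂ b ha1 ha2 (hcol _ h1) h3 (hcol _ h2) h4 (hreach pq hpq) with hr | ⟨w, hw, hr⟩
    · exact absurd hr hnot
    · exact ⟨pq, hpq, w, hw, hr⟩

/-- The window events increase to the target event. [folklore] -/
theorem Ewin_mono (i : ℤ) (τ κ₀ κ₂ : Bool) (F₁ F₂ : Finset ℤ) (g₁ g₂ : ℤ → Bool) (Pp : Finset (Site 2 × Site 2)) {m m' : ℕ}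
    (h : m ≤ m') : Ewin i τ κ₀ κ₂ F₁ F₂ g₁ g₂ Pp m ⊆ Ewin i τ κ₀ κ₂ F₁ F₂ g₁ g₂ Pp m' := by
  rintro b ⟨hB, hD⟩
  exact ⟨hB, fun pq hpq => DgW_mono (by omega) (by omega) _ (hD pq hpq)⟩

/-- The window events exhaust the target event. [folklore] -/
theorem iUnion_Ewin (i : ℤ) (τ κ₀ κ₂ : Bool) (F₁ F₂ : Finset ℤ) (g₁ g₂ : ℤ → Bool) (Pp : Finset (Site 2 × Site 2)) :
    ⋃ m : ℕ, Ewin i τ κ₀ κ₂ F₁ F₂ g₁ g₂ Pp m = Einf i τ κ₀ κ₂ F₁ F₂ g₁ g₂ Pp := by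
  ext b
  simp only [Set.mem_iUnion]
  constructor
  · rintro ⟨m, hB, hD⟩
    exact ⟨hB, fun pq hpq => DgW_subset _ _ _ _ (hD pq hpq)⟩
  · rintro ⟨hB, hD⟩
    have key : ∀ s : Finset (Site 2 × Site 2), s ⊆ Pp → ∃ m : ℕ, ∀ pq ∈ s, pq ∈ DgW i (-m) m (X i τ κ₀ κ₂ b) := by
      intro s
      induction s using Finset.induction_on with
      | empty => intro _; exact ⟨0, fun pq hpq => absurd hpq (Finset.notMem_empty _)⟩
      | insert pq s hpq ih =>
        intro hs
        obtain ⟨m, hm⟩ := ih ((Finset.subset_insert _ _).trans hs)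
        obtain ⟨m', hm'⟩ := exists_DgW i _ (hD pq (hs (Finset.mem_insert_self _ _)))
        refine ⟨max m m', fun pq' hpq' => ?_⟩
        rcases Finset.mem_insert.1 hpq' with rfl | hpq'
        · exact DgW_mono (by omega) (by omega) _ hm'
        · exact DgW_mono (by omega) (by omega) _ (hm pq' hpq')
    obtain ⟨m, hm⟩ := key Pp le_rfl
    exact ⟨m, hB, hm⟩

/-! ## §14 Locality of the events -/

/-- The boundary-condition event reads the window. [folklore] -/
theorem Bev_det (κ₀ κ₂ : Bool) (F₁ F₂ : Finset ℤ) (g₁ g₂ : ℤ → Bool) (M : ℕ) (hF : ∀ y ∈ F₁ ∪ F₂, -(M : ℤ) ≤ y ∧ y ≤ M) :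
    Bev κ₀ κ₂ F₁ F₂ g₁ g₂ ∈ DetSets (Jw (-M) M) := by
  intro b b' h
  simp only [Bev, Set.mem_setOf_eq, bdry_eq true]
  have e : ∀ y ∈ F₁ ∪ F₂, ∀ j : Fin 3, col true κ₀ κ₂ b j y = col true κ₀ κ₂ b' j y := fun y hy j =>
    col_local true κ₀ κ₂ (by omega) (by omega) h j y (hF y hy).1 (hF y hy).2
  constructor
  · rintro ⟨hb1, hb2⟩
    exact ⟨fun y hy => by rw [← e y (Finset.mem_union_left _ hy) 0]; exact hb1 y hy,
      fun y hy => by rw [← e y (Finset.mem_union_right _ hy) 2]; exact hb2 y hy⟩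
  · rintro ⟨hb1, hb2⟩
    exact ⟨fun y hy => by rw [e y (Finset.mem_union_left _ hy) 0]; exact hb1 y hy,
      fun y hy => by rw [e y (Finset.mem_union_right _ hy) 2]; exact hb2 y hy⟩

/-- The window event reads the window. [folklore] -/
theorem Ewin_det (i : ℤ) (τ κ₀ κ₂ : Bool) (F₁ F₂ : Finset ℤ) (g₁ g₂ : ℤ → Bool) (Pp : Finset (Site 2 × Site 2)) (m M : ℕ)
    (hm : m ≤ M) (hF : ∀ y ∈ F₁ ∪ F₂, -(M : ℤ) ≤ y ∧ y ≤ M) : Ewin i τ κ₀ κ₂ F₁ F₂ g₁ g₂ Pp m ∈ DetSets (Jw (-M) M) := by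
  intro b b' h
  have hJ : ∀ {c c' : K}, (∀ j ∈ Jw (-M) M, c j = c' j) → ∀ j ∈ Jw (-m) m, c j = c' j := fun hc j hj => by
    obtain ⟨k, y⟩ := j
    rw [mem_Jw] at hj
    exact hc _ ((mem_Jw _ _ k y).2 (by omega))
  simp only [Ewin, Set.mem_inter_iff, Set.mem_setOf_eq]
  rw [Bev_det κ₀ κ₂ F₁ F₂ g₁ g₂ M hF b b' h]
  constructor
  · rintro ⟨hB, hD⟩
    exact ⟨hB, fun pq hpq => DgW_local i τ κ₀ κ₂ (by omega) (by omega) (hJ h) pq (hD pq hpq)⟩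
  · rintro ⟨hB, hD⟩
    exact ⟨hB, fun pq hpq => DgW_local i τ κ₀ κ₂ (by omega) (by omega) (hJ fun j hj => (h j hj).symm) pq (hD pq hpq)⟩

/-- The exit event reads the window. [folklore] -/
theorem Gex_det (i : ℤ) (τ κ₀ κ₂ : Bool) (Pp : Finset (Site 2 × Site 2)) (m M : ℕ) (hm : m ≤ M)
    (hPp : ∀ pq ∈ Pp, (pq.1 0 = i ∨ pq.1 0 = i + 2) ∧ (pq.2 0 = i ∨ pq.2 0 = i + 2) ∧
      (-(m : ℤ) ≤ pq.1 1 ∧ pq.1 1 ≤ m) ∧ (-(m : ℤ) ≤ pq.2 1 ∧ pq.2 1 ≤ m)) :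
    Gex i τ κ₀ κ₂ Pp m ∈ DetSets (Jw (-M) M) := by
  intro b b' h
  have hJ : ∀ {c c' : K}, (∀ j ∈ Jw (-M) M, c j = c' j) → ∀ j ∈ Jw (-m) m, c j = c' j := fun hc j hj => by
    obtain ⟨k, y⟩ := j
    rw [mem_Jw] at hj
    exact hc _ ((mem_Jw _ _ k y).2 (by omega))
  simp only [Gex, Set.mem_setOf_eq]
  constructor
  · rintro ⟨pq, hpq, w, hw, hr⟩
    obtain ⟨h1, -, h3, -⟩ := hPp pq hpq
    exact ⟨pq, hpq, w, hw, reachW_local i τ κ₀ κ₂ (by omega) (by omega) (hJ h) _ _ (by omega) (by omega) h3.1 h3.2 hr⟩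
  · rintro ⟨pq, hpq, w, hw, hr⟩
    obtain ⟨h1, -, h3, -⟩ := hPp pq hpq
    exact ⟨pq, hpq, w, hw, reachW_local i τ κ₀ κ₂ (by omega) (by omega) (hJ fun j hj => (h j hj).symm) _ _
      (by omega) (by omega) h3.1 h3.2 hr⟩


end SDE

/-- INCLUSIONS OF THE LIMIT ARGUMENT (part 5 of `stub_StripDiagramExchange`): window connections are cylinder connections, and cylinder connections are window connections or exits. [folklore] -/
theorem stripDX_inclusions : ∀ (i : ℤ) (τ κ₀ κ₂ : Bool) (F₁ F₂ : Finset ℤ) (g₁ g₂ : ℤ → Bool) (Pp : Finset (Site 2 × Site 2)) (m N : ℕ) [NeZero N], 2 * m + 4 ≤ N → (∀ y ∈ F₁ ∪ F₂, -(m : ℤ) ≤ y ∧ y ≤ m) → (∀ pq ∈ Pp, (pq.1 0 = i ∨ pq.1 0 = i + 2) ∧ (pq.2 0 = i ∨ pq.2 0 = i + 2) ∧ (-(m : ℤ) ≤ pq.1 1 ∧ pq.1 1 ≤ m) ∧ (-(m : ℤ) ≤ pq.2 1 ∧ pq.2 1 ≤ m)) → SDE.Ewin i τ κ₀ κ₂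 F₁ F₂ g₁ g₂ Pp m ∩ SDE.Per (SDE.aN N) N ⊆ SDE.Ecyl i τ κ₀ κ₂ F₁ F₂ g₁ g₂ Pp N ∧ SDE.Ecyl i τ κ₀ κ₂ F₁ F₂ g₁ g₂ Pp N ⊆ SDE.Ewin i τ κ₀ κ₂ F₁ F₂ g₁ g₂ Pp m ∪ SDE.Gex i τ κ₀ κ₂ Pp m :=
  fun i τ κ₀ κ₂ F₁ F₂ g₁ g₂ Pp m N _ hN hF hPp =>
    ⟨SDE.Ewin_subset_Ecyl i τ κ₀ κ₂ F₁ F₂ g₁ g₂ Pp m N hN hF, SDE.Ecyl_subset i τ κ₀ κ₂ F₁ F₂ g₁ g₂ Pp m N hN hF hPp⟩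

end Summit.CriticalPhenomena.CardyFormulaZ2.Theorems.IKLinearTransport.PinnedDiagramExchange
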